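import Summits.RiemannHypothesis.RiemannHypothesis.Theorems.TiltedLandingLaw421R3BurgersRate

/-!
# LEADING-ORDER DISSIPATION IDENTITY (lens-2 g5; ★A / C′ at large floor λ — HELD memo material, pure algebra)

In the far-field-dominated regime (`F` real, `|F| → ∞`, children `u_i = w_i − 1/F + S_i/F² + O(F⁻³)`, `S_i = Σ_{k≠i} 1/(w_i − w_k)`) the
dimensionless drop of the touching pair `{v, z}` is `X = ΔE·κ_v² → X₀ := −2·(Im v·Im S_v + Im z·Im S_z)`.  Splitting `S` into the partners
(`Im 1/(v − v̄) = −1/(2·Im v)`: contributes `+1` each), the CROSS pulls of the pair on each other, and the foreign pulls: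
`X₀ = 2 − 2·(Im v·P(v,z) + Im z·P(z,v)) − 2·Σ_foreign (Im v·P(v,u) + Im z·P(z,u))`, `P(w,u) = (Im u − Im w)/|w−u|² − (Im u + Im w)/|w−ū|²`.
★ `cross_identity`: with `a = Im v`, `b = Im z`, `Δ = Re v − Re z`, `N₁ = Δ² + (a−b)²`, `N₂ = Δ² + (a+b)²`:
  `a·P(v,z) + b·P(z,v) = −(a−b)²/N₁ − (a+b)²/N₂`  — ALWAYS ≤ 0, so the pair's mutual interaction only ADDS dissipation;
★ `leading_ge_two`: `2 ≤ 2 − 2·(a·P(v,z) + b·P(z,v))` for any two upper zeros;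
★ `leading_ge_three_of_touch`: `|Δ| ≤ a + b` (touching) ⇒ `3 ≤ 2 − 2·(a·P(v,z) + b·P(z,v))` (`(a+b)²/N₂ ≥ 1/2`);
and the foreign terms are `≥ 0` whenever `v` and `z` are UNCOVERED by the foreign zero (the uncovered-sign identity `pairPull_nonpos_iff` of
`UncoveredSign`, not re-proved here).  This is the closed form behind the bench envelope `X ≥ 3 − 4.33/λ` (instr-1 TPRICE) and the reason C′(3/2, 3)
has room at large `λ`; the `O(1/λ)` corrections are NOT controlled here (min X = 2.0–2.6 lives at `λ ∈ [3, 6]`).  Tree import only; 0 sorry.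
Nothing here bears on the truth of RH; RH is not proved; C′/T″ typed not proved; ★A / 33346 / 33347 OPEN.
-/

namespace RhW08.LeadingDissipation

/-- the vertical pull of the pair at height `b`, lateral offset `Δ`, on a point at height `a`: `(b − a)/(Δ² + (a−b)²) − (a + b)/(Δ² + (a+b)²)`. -/
noncomputable def pull (a b Δ : ℝ) : ℝ := (b - a) / (Δ ^ 2 + (a - b) ^ 2) - (a + b) / (Δ ^ 2 + (a + b) ^ 2)

/-- `pull` is symmetric in the sign of `Δ` (so `P(z,v)` uses the same `Δ²`). -/
theorem pull_neg_delta (a b Δ : ℝ) : pull a b (-Δ) = pull a b Δ := by simp [pull]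

/-- ★ THE CROSS IDENTITY: `a·P(v,z) + b·P(z,v) = −(a−b)²/N₁ − (a+b)²/N₂`. -/
theorem cross_identity (a b Δ : ℝ) :
    a * pull a b Δ + b * pull b a Δ = -((a - b) ^ 2 / (Δ ^ 2 + (a - b) ^ 2)) - (a + b) ^ 2 / (Δ ^ 2 + (a + b) ^ 2) := by
  simp only [pull]
  have h1 : (b - a) ^ 2 = (a - b) ^ 2 := by ring
  rw [h1, show b + a = a + b by ring]
  ring

/-- the cross term is `≤ 0`: the two zeros of a pair only ever add to each other's leading-order dissipation. -/
theorem cross_nonpos (a b Δ : ℝ) : a * pull a b Δ + b * pull b a Δ ≤ 0 := by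
  rw [cross_identity]
  have h1 : 0 ≤ (a - b) ^ 2 / (Δ ^ 2 + (a - b) ^ 2) := div_nonneg (sq_nonneg _) (by positivity)
  have h2 : 0 ≤ (a + b) ^ 2 / (Δ ^ 2 + (a + b) ^ 2) := div_nonneg (sq_nonneg _) (by positivity)
  linarith

/-- ★ `X₀ ≥ 2` for ANY pair of upper zeros (before foreign terms). -/
theorem leading_ge_two (a b Δ : ℝ) : 2 ≤ 2 - 2 * (a * pull a b Δ + b * pull b a Δ) := by
  have := cross_nonpos a b Δ; linarith

/-- ★ `X₀ ≥ 3` for a TOUCHING pair (`|Δ| ≤ a + b`, `0 < a + b`): the conjugate attraction term `(a+b)²/N₂` is `≥ 1/2`. -/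
theorem leading_ge_three_of_touch {a b Δ : ℝ} (hab : 0 < a + b) (ht : |Δ| ≤ a + b) :
    3 ≤ 2 - 2 * (a * pull a b Δ + b * pull b a Δ) := by
  rw [cross_identity]
  have hN2 : 0 < Δ ^ 2 + (a + b) ^ 2 := by positivity
  have hΔ : Δ ^ 2 ≤ (a + b) ^ 2 := by
    have h := sq_le_sq' (by linarith [neg_abs_le Δ, abs_nonneg Δ]) ht
    simpa using h
  have h2 : 1 / 2 ≤ (a + b) ^ 2 / (Δ ^ 2 + (a + b) ^ 2) := by
    rw [div_le_div_iff₀ (by norm_num) hN2]; nlinarith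
  have h1 : 0 ≤ (a - b) ^ 2 / (Δ ^ 2 + (a - b) ^ 2) := div_nonneg (sq_nonneg _) (by positivity)
  linarith

/-- ★ the foreign terms: if a foreign pair pulls BOTH `v` and `z` down or not at all (`P(v,u) ≤ 0`, `P(z,u) ≤ 0` — both uncovered by `u`), its
contribution `−2·(a·P(v,u) + b·P(z,u))` to `X₀` is `≥ 0`. -/
theorem foreign_nonneg {a b Pv Pz : ℝ} (ha : 0 ≤ a) (hb : 0 ≤ b) (hv : Pv ≤ 0) (hz : Pz ≤ 0) : 0 ≤ -2 * (a * Pv + b * Pz) := by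
  nlinarith [mul_nonpos_iff.2 (Or.inl ⟨ha, hv⟩), mul_nonpos_iff.2 (Or.inl ⟨hb, hz⟩)]

/-- the WΓ numbers (`a = 1/10`, `b = 1/5`, `Δ = 4/25`): `X₀ = 2 + 0.5618 + 1.5571 = 4.119` — bracket `4.11 < X₀ < 4.12`. -/
example : (411 : ℝ) / 100 < 2 - 2 * ((1 / 10) * pull (1 / 10) (1 / 5) (4 / 25) + (1 / 5) * pull (1 / 5) (1 / 10) (4 / 25)) ∧
    2 - 2 * ((1 / 10) * pull (1 / 10) (1 / 5) (4 / 25) + (1 / 5) * pull (1 / 5) (1 / 10) (4 / 25)) < (412 : ℝ) / 100 := by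
  constructor <;> norm_num [pull]

end RhW08.LeadingDissipation
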